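import Summits.BirchSwinnertonDyer.BirchSwinnertonDyer.Theorems.PrintCf2RubinValueTwoKatzJZeroRangeDecomposition
import Literature.NumberTheory.LFunctions.GrossencharakterWeightOneNorm
import Literature.NumberTheory.Automorphic.JacquetLanglandsParts
import Literature.NumberTheory.NumberFields.AdicCompletionIntegersPadicIntOfDegreeOne
import HarnessLib

set_option linter.dupNamespace false
set_option autoImplicit false

/-!
# The (e)-ASSEMBLY, TOP FILE: the integrand clause of the `j = 0` endpoint from the TWISTED CLASS-SUM
# IDENTITY at one deep level (de Shalit II.4.14: (36) ⇐ (38)–(40), the last three lines of the proof)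

Cell `bsd-print-cf2`, width seat `bsd-line-cf2-p1-w3` g31; print leaf 24720 `KatzDistributionsAtTwoPrint` under director
OPTION 1 (`j = 0` twin), R3 endpoint `Cruxes/KatzDistributionsAtTwoPrint/Lines/katz_measure_two_R3_endpoint.lean`
(`KatzMeasureTwo.lMeasureJZero_classNumberOne_two`).  `--supports stmt-BirchSwinnertonDyer-24720` (helper, Theses-free).
THEOREMS ONLY (no `def`, no named fact, no `sorry`); nothing is closed; no summit statement is proved by this seat;
BSD is not proved by any of this.

WHAT.  The endpoint asks, for a bounded distribution `μ` on `Γ_K` and EVERY range character `ε` (type `(−m, 0)`,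
`m ≥ 3`, unramified off `S ∪ {v̄}`, relative avatar `e` outside `S`, tower-continuous, entire `L(ε, s)`):
`∫_{Γ_K} ê dμ = ι⁻¹(interpolationValue 2 v v̄ S ε m 0 Ω δ L(ε,0)) · Ω₂^m`.  The measure lane computes instead,
at a LEVEL `M` and for an auxiliary TWIST `𝔠` (de Shalit's (38)–(40) with `μ_𝔞 = 12(σ_𝔞 − N𝔞)μ`), the quantity
`(N𝔠 − ê(g_𝔠)) · ∫ ê dμ` as a class sum of Eisenstein numbers — in the complex currency of -w7 g14's
`KatzJZeroRange.twist_mul_interpolationValue_zero_eq_eulerFactor_mul_sum` (A8):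
`(1 − ε(ϖ_v)⁻¹2⁻¹) · Σ_{𝔟∈T} χ̃(𝔟)⁻¹ λ̃(𝔟)^{−m} (N𝔠·E_m(Ω, L 𝔟) − E_m(Ω, L(𝔠𝔟)))`, with `ê(g_𝔠) = ι⁻¹(χ̃(𝔠)λ̃(𝔠)^m)`.
THIS FILE is the top of that assembly: **`integral_avatar_eq_interpolationValue_of_twistedClassSums`** — GIVEN that
twisted class-sum identity at all deep levels `M ≥ M₁` (hypothesis `hsum`, the seam the lane's H11 ∘ A9 ∘ MI ∘ bridge
chain concludes; stated for ANY tower `𝒰`, ANY `μ`, ANY `Ω ≠ 0`, `δ`, `Ω₂`), the endpoint's integrand clause holds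
for EVERY range character.  The file discharges everything between the seam and the clause:
the auxiliary type-`(1,0)` character `λ` unramified off `v̄` (`h_K = 1`, -w5 g15 `KatzJZeroUnique.exists_char_type_neg_one`),
the level `M` with the range decomposition `ε = χ̃⁻¹λ̃^{−m}` (-w7 g14 `exists_rayClassCharacter_range_decomposition`),
`w_{𝔪_M} = 1` and `𝔪_M ≠ (1)` (`v̄² ∣ 𝔪_M`, -w5 `units_eq_one_of_sub_one_mem_sq`), a twisting PRIME `𝔠 ∉ S ∪ {v, v̄}`
(infinitely many primes), the NON-VANISHING `N𝔠 ≠ χ̃(𝔠)λ̃(𝔠)^m` (weights: `|χ̃(𝔠)λ̃(𝔠)^m| = N𝔠^{m/2}`, `m ≥ 3`,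
`N𝔠 ≥ 2`; `GrossencharakterWeightOneNorm`), A8, and the cancellation.

* §1 `exists_heightOneSpectrum_not_mem` — a prime outside any finite set (the tree's `infinite_heightOneSpectrum`).
* §2 `modulusIdeal_const_le_sq`, `units_eq_one_of_sub_one_mem_modulusIdeal_const`, `modulusIdeal_const_ne_top` — the moduli
  `𝔪_M = ∏_{w ∈ S ∪ {v̄}} w^{M+1}`, `M ≥ 1`, are rigid and proper.
* §3 `norm_classCoeff_eq`, `absNorm_sub_classCoeff_ne_zero` — `|χ̃(𝔠)λ̃(𝔠)^m| = N𝔠^{m/2}` and `N𝔠 − χ̃(𝔠)λ̃(𝔠)^m ≠ 0`.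
* §4 ★★ `integral_avatar_eq_interpolationValue_of_twistedClassSums` — THE TOP.

HONEST FRAMING: plumbing of accepted kernel theorems; the analytic identity is the HYPOTHESIS `hsum`; the ∃-packaging of
the endpoint (choice of `Ω, Ω₂`, the tower, openness, `⋂ U_n ⊆ rayKer`, `‖μ‖ ≤ 1`) is NOT here (it waits for the lane's
varying-step chain, -w8 g11 H10).

References: [deShalit1987] II.4.14 (36)–(40) (p. 71–73), II.4.11 (29), II.4.12 (31)–(32) (p. 65–69), II.1.1 (p. 32–33);
[NeukirchANT1999] Ch. VII §6 (6.9)–(6.14), Ch. I §3 (3.1).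
-/

noncomputable section

open scoped NumberField Classical nonZeroDivisors
open NumberField IsDedekindDomain Field
open Literature Literature.NumberTheory.GaloisRepresentations Literature.NumberTheory.EllipticCurves
open Literature.NumberTheory.LFunctions Literature.NumberTheory.NumberFields
open Literature.NumberTheory.EllipticCurves.DeShalit1987 Literature.NumberTheory.GaloisRepresentations.HeckeCharacter

namespace Summit.BirchSwinnertonDyer.BirchSwinnertonDyer.Theorems.PrintCf2.KatzMeasureJZeroTop

variable {K : Type} [Field K] [NumberField K]

/-! ## §1 A prime outside any finite set -/

/-- There is a prime of `K` outside any finite set of primes (a number field has infinitely many primes: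
the tree's `Literature.NumberTheory.Automorphic.infinite_heightOneSpectrum`). [folklore] -/
theorem exists_heightOneSpectrum_not_mem (F : Finset (HeightOneSpectrum (𝓞 K))) :
    ∃ q : HeightOneSpectrum (𝓞 K), q ∉ F :=
  haveI := Literature.NumberTheory.Automorphic.infinite_heightOneSpectrum K
  Infinite.exists_notMem_finset F

/-! ## §2 The moduli `𝔪_M = ∏_{w ∈ S ∪ {v̄}} w^{M+1}` -/

omit [NumberField K] in
/-- `𝔪_M ≤ v̄²` for `M ≥ 1`. [cite: deShalit1987, II.4.12 (p. 66)] -/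
theorem modulusIdeal_const_le_sq (T : Finset (HeightOneSpectrum (𝓞 K))) {vbar : HeightOneSpectrum (𝓞 K)}
    (hvbar : vbar ∈ T) {M : ℕ} (hM : 1 ≤ M) :
    modulusIdeal T (fun _ ↦ M) ≤ vbar.asIdeal ^ 2 := by
  unfold modulusIdeal
  rw [← Finset.prod_erase_mul _ _ hvbar]
  have h : vbar.asIdeal ^ (M + 1) ≤ vbar.asIdeal ^ 2 := Ideal.pow_le_pow_right (by omega)
  exact Ideal.mul_le_left.trans h

/-- `w_{𝔪_M} = 1` for `M ≥ 1` at a split `2 = v v̄` of an imaginary quadratic field (`𝒪_{v̄} ≅ ℤ₂`, one infinite place):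
a unit `≡ 1 (mod v̄²)` is `1`. [cite: deShalit1987, II.4.12 (p. 66)] -/
theorem units_eq_one_of_sub_one_mem_modulusIdeal_const (T : Finset (HeightOneSpectrum (𝓞 K)))
    {vbar : HeightOneSpectrum (𝓞 K)} (hvbar : vbar ∈ T) (e : vbar.adicCompletionIntegers K ≃+* ℤ_[2])
    {w₀ : InfinitePlace K} (hw₀ : ∀ w : InfinitePlace K, w = w₀) {M : ℕ} (hM : 1 ≤ M)
    (u : (𝓞 K)ˣ) (hu : (u : 𝓞 K) - 1 ∈ modulusIdeal T (fun _ ↦ M)) : u = 1 :=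
  KatzJZeroUnique.units_eq_one_of_sub_one_mem_sq e hw₀ u (modulusIdeal_const_le_sq T hvbar hM hu)

omit [NumberField K] in
/-- `𝔪_M ≠ (1)` for `M ≥ 1` (it is divisible by `v̄²`). [cite: deShalit1987, II.4.12 (p. 66)] -/
theorem modulusIdeal_const_ne_top (T : Finset (HeightOneSpectrum (𝓞 K))) {vbar : HeightOneSpectrum (𝓞 K)}
    (hvbar : vbar ∈ T) {M : ℕ} (hM : 1 ≤ M) : modulusIdeal T (fun _ ↦ M) ≠ ⊤ := by
  intro h
  have h2 : vbar.asIdeal ^ 2 = ⊤ := top_le_iff.mp (h ▸ modulusIdeal_const_le_sq T hvbar hM)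
  exact vbar.isPrime.ne_top ((Ideal.pow_eq_top_iff.mp h2).resolve_right (by norm_num))

/-! ## §3 The twisting coefficient `χ̃(𝔠)λ̃(𝔠)^m`: absolute value `N𝔠^{m/2}`, hence `≠ N𝔠` -/

/-- **`‖χ̃(𝔠)·λ̃(𝔠)^m‖ = (√N𝔠)^m`** for a ray class character `χ̃` mod `𝔪` and `λ` of type `(1,0)` with module of definition
`𝔪` (`‖χ̃(𝔠)‖ = 1`, `‖λ̃(𝔠)‖ = √N𝔠`), `𝔠 ≠ 0` prime to `𝔪`. [cite: deShalit1987, II.1.1 (p. 32–33)]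
[cite: NeukirchANT1999, Ch. VII §6 Prop. (6.13)] -/
theorem norm_classCoeff_eq [IsTotallyComplex K] (h2 : Module.finrank ℚ K = 2) (w₀ : InfinitePlace K)
    {lam : HeckeCharacter K} {T : Finset (HeightOneSpectrum (𝓞 K))} {M : ℕ}
    (hl : lam.HasInfinityType (fun _ ↦ 1) (fun _ ↦ 0)) (hlmod : lam.IsModulus T (fun _ ↦ M))
    {χ : HeightOneSpectrum (𝓞 K) → ℂ} (hχ : IsRayClassCharacter (modulusIdeal T (fun _ ↦ M)) χ)
    {𝔠 : Ideal (𝓞 K)} (h𝔠0 : 𝔠 ≠ ⊥) (h𝔠cop : IsCoprime 𝔠 (modulusIdeal T (fun _ ↦ M))) (m : ℕ) :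
    ‖idealPow K χ 𝔠 * idealPow K (fun w ↦ lam.valueAtUniformizer w) 𝔠 ^ m‖ =
      Real.sqrt ((Ideal.absNorm 𝔠 : ℕ) : ℝ) ^ m := by
  rw [norm_mul, norm_pow, hχ.norm_idealPow (modulusIdeal_ne_bot T _) h𝔠0 h𝔠cop, one_mul,
    norm_idealPow_eq_sqrt_absNorm h2 w₀.embedding (modulusIdeal_ne_bot T _)
      (valueAtUniformizer_ne_zero_of_not_le lam _)
      (fun b c hb hc hcop hbc ↦ HasInfinityType.idealPow_span_mul_embedding_eq h2 w₀ hl hlmod b c hb hc hcop hbc) h𝔠0 h𝔠cop]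

/-- **`N𝔠 − χ̃(𝔠)λ̃(𝔠)^m ≠ 0`** for `m ≥ 3` and `𝔠 ≠ (1)`: `‖χ̃(𝔠)λ̃(𝔠)^m‖ = N𝔠^{m/2} > N𝔠` since `N𝔠 ≥ 2` (de Shalit's
"`N𝔞 − ε(σ_𝔞) ≠ 0` by weights"). [cite: deShalit1987, II.4.14 (38) (p. 72), II.1.1 (p. 32–33)] -/
theorem absNorm_sub_classCoeff_ne_zero [IsTotallyComplex K] (h2 : Module.finrank ℚ K = 2) (w₀ : InfinitePlace K)
    {lam : HeckeCharacter K} {T : Finset (HeightOneSpectrum (𝓞 K))} {M : ℕ}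
    (hl : lam.HasInfinityType (fun _ ↦ 1) (fun _ ↦ 0)) (hlmod : lam.IsModulus T (fun _ ↦ M))
    {χ : HeightOneSpectrum (𝓞 K) → ℂ} (hχ : IsRayClassCharacter (modulusIdeal T (fun _ ↦ M)) χ)
    {𝔠 : Ideal (𝓞 K)} (h𝔠0 : 𝔠 ≠ ⊥) (h𝔠1 : 𝔠 ≠ ⊤) (h𝔠cop : IsCoprime 𝔠 (modulusIdeal T (fun _ ↦ M)))
    {m : ℕ} (hm : 3 ≤ m) :
    (Ideal.absNorm 𝔠 : ℂ) - idealPow K χ 𝔠 * idealPow K (fun w ↦ lam.valueAtUniformizer w) 𝔠 ^ m ≠ 0 := by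
  intro h
  have heq : idealPow K χ 𝔠 * idealPow K (fun w ↦ lam.valueAtUniformizer w) 𝔠 ^ m = (Ideal.absNorm 𝔠 : ℂ) :=
    (sub_eq_zero.mp h).symm
  have hnorm := norm_classCoeff_eq h2 w₀ hl hlmod hχ h𝔠0 h𝔠cop m
  rw [heq] at hnorm
  have hN : ‖(Ideal.absNorm 𝔠 : ℂ)‖ = ((Ideal.absNorm 𝔠 : ℕ) : ℝ) := by
    rw [show (Ideal.absNorm 𝔠 : ℂ) = ((Ideal.absNorm 𝔠 : ℕ) : ℝ) by push_cast; rfl, Complex.norm_real,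
      Real.norm_of_nonneg (Nat.cast_nonneg _)]
  rw [hN] at hnorm
  -- `N𝔠 ≥ 2`
  have hN2 : 2 ≤ Ideal.absNorm 𝔠 := by
    have h0 : Ideal.absNorm 𝔠 ≠ 0 := by rwa [Ne, Ideal.absNorm_eq_zero_iff]
    have h1 : Ideal.absNorm 𝔠 ≠ 1 := by rwa [Ne, Ideal.absNorm_eq_one_iff]
    omega
  set N : ℝ := ((Ideal.absNorm 𝔠 : ℕ) : ℝ) with hNdef
  have hN1 : (1 : ℝ) < N := by rw [hNdef]; exact_mod_cast hN2
  have hN0 : (0 : ℝ) ≤ N := by rw [hNdef]; exact Nat.cast_nonneg _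
  -- square: `N² = (√N)^{2m} = N^m`
  have hsq : N ^ 2 = N ^ m := by
    calc N ^ 2 = (Real.sqrt N ^ m) ^ 2 := by rw [← hnorm]
      _ = (Real.sqrt N ^ 2) ^ m := by ring
      _ = N ^ m := by rw [Real.sq_sqrt hN0]
  have hlt : N ^ 2 < N ^ m := pow_lt_pow_right₀ hN1 (by omega)
  exact hlt.ne hsq

/-! ## §4 THE TOP: the integrand clause from the twisted class-sum identity -/

set_option maxHeartbeats 400000 in
/-- ★★ **THE (e)-ASSEMBLY, TOP FILE: the `j = 0` endpoint's integrand clause for EVERY range character, from the TWISTED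
CLASS-SUM IDENTITY at deep levels** (de Shalit II.4.14: (36) from (38)–(40), the division by `12(N𝔞 − ε(σ_𝔞))`).
Frame: `K` imaginary quadratic with `h_K = 1`, `2 = v·v̄` (`v̄ ≠ v`), `S ∌ v, v̄`, any `Ω ≠ 0`, `δ`, `Ω₂ ∈ ℂ₂`, any tower
`𝒰` of `Γ_K` and bounded distribution `μ` along it.  SEAM `hsum` (the lane's p-adic computation, -w8 H11 ∘ -w5 A9 ∘ -w2 MI ∘
cf2c-w4 bridge, read through `ι`): there is a threshold `M₁` such that for every infinite place `w₀`, every `λ` of type `(1,0)`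
with module of definition `(S ∪ {v̄}, M)`, `M ≥ M₁`, `𝔪_M := ∏_{w∈S∪{v̄}} w^{M+1} ≠ (1)` with `w_{𝔪_M} = 1`, every ray class
character `χ̃` mod `𝔪_M`, every twist `𝔠 ≠ 0` prime to `𝔪_M` and to `v`, and every range character `ε` (relative avatar
`e` outside `S`, `3 ≤ m`, type `(−m,0)`, unramified off `S ∪ {v̄}`, `ê` tower-continuous) decomposed as
`ε(ϖ_w) = χ̃(w)⁻¹λ̃(w)^{−m}` off `𝔪_M`, with entire `L(ε,s)`: for SOME representatives `T` of the ray classes mod `𝔪_M` and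
class lattices `Λ_{L 𝔟} = Ω·σ(𝔪_M/𝔟)` (`𝔟 ∈ T ∪ 𝔠T`),
`(N𝔠 − ι⁻¹(χ̃(𝔠)λ̃(𝔠)^m)) · ∫_{Γ_K} ê dμ = ι⁻¹((1 − ε(ϖ_v)⁻¹2⁻¹) · Σ_{𝔟∈T} χ̃(𝔟)⁻¹λ̃(𝔟)^{−m}(N𝔠·E_m(Ω, L 𝔟) − E_m(Ω, L(𝔠𝔟)))) · Ω₂^m`.
CONCLUSION: `∫_{Γ_K} ê dμ = ι⁻¹(interpolationValue 2 v v̄ S ε m 0 Ω δ L(ε,0)) · Ω₂^{m+0}` — the endpoint's clause VERBATIM.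
Proof: `λ` from `KatzJZeroUnique.exists_char_type_neg_one` (`h_K = 1`, `𝒪_{v̄} ≅ ℤ₂`), `(M, χ̃)` from
`KatzJZeroRange.exists_rayClassCharacter_range_decomposition`, `𝔠` a prime outside `S ∪ {v, v̄}`, then A8
`twist_mul_interpolationValue_zero_eq_eulerFactor_mul_sum` identifies the right side with `ι⁻¹((N𝔠 − χ̃(𝔠)λ̃(𝔠)^m)·value)·Ω₂^m`
and `N𝔠 − χ̃(𝔠)λ̃(𝔠)^m ≠ 0` (§3) cancels.
[cite: deShalit1987, II.4.14 (36)–(40) (p. 71–73), II.4.11 (29), II.4.12 (31)–(32) (p. 65–69)] -/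
theorem integral_avatar_eq_interpolationValue_of_twistedClassSums
    (hK : IsImaginaryQuadratic K) (hh : NumberField.classNumber K = 1) (ι : PadicAlgCl 2 ≃+* ℂ)
    {v vbar : HeightOneSpectrum (𝓞 K)}
    (hv : ((2 : ℕ) : 𝓞 K) ∈ v.asIdeal) (hvbar : ((2 : ℕ) : 𝓞 K) ∈ vbar.asIdeal) (hne : vbar ≠ v)
    {S : Finset (HeightOneSpectrum (𝓞 K))} (hvS : v ∉ S)
    {Ω : ℂ} (hΩ : Ω ≠ 0) (δ : ℂ) (Ωp : ℂ_[2])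
    {𝒰 : SubgroupTower (absoluteGaloisGroup K)} (μ : GroupDistribution 𝒰 ℂ_[2])
    (hsum : ∃ M₁ : ℕ, ∀ (w₀ : InfinitePlace K) (lam : HeckeCharacter K) (M : ℕ), M₁ ≤ M →
      lam.HasInfinityType (fun _ ↦ 1) (fun _ ↦ 0) →
      lam.IsModulus (insert vbar S) (fun _ ↦ M) →
      modulusIdeal (insert vbar S) (fun _ ↦ M) ≠ ⊤ →
      (∀ u : (𝓞 K)ˣ, (u : 𝓞 K) - 1 ∈ modulusIdeal (insert vbar S) (fun _ ↦ M) → u = 1) →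
      ∀ (χ : HeightOneSpectrum (𝓞 K) → ℂ), IsRayClassCharacter (modulusIdeal (insert vbar S) (fun _ ↦ M)) χ →
      ∀ (𝔠 : Ideal (𝓞 K)), 𝔠 ≠ ⊥ → IsCoprime 𝔠 (modulusIdeal (insert vbar S) (fun _ ↦ M)) →
        IsCoprime 𝔠 v.asIdeal →
      ∀ (ε : HeckeCharacter K) (e : FramedGaloisRep K (PadicAlgCl 2) 1) (m : ℕ),
        IsPAdicAvatarOutside S ι ε e → 3 ≤ m →
        ε.HasInfinityType (fun _ ↦ -(m : ℤ)) (fun _ ↦ 0) →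
        (∀ w : HeightOneSpectrum (𝓞 K), w ∉ S → w ≠ vbar → ε.IsUnramifiedAt w) →
        𝒰.IsTowerContinuous (fun σ ↦ avatarValueAt e σ) →
        (∀ w : HeightOneSpectrum (𝓞 K), ¬ modulusIdeal (insert vbar S) (fun _ ↦ M) ≤ w.asIdeal →
          ε.valueAtUniformizer w = (χ w)⁻¹ * (lam.valueAtUniformizer w ^ m)⁻¹) →
        ∀ hL : LFunction.HasEntireContinuation (heckeLFunction ε),
        ∃ (T : Finset (Ideal (𝓞 K))) (L : Ideal (𝓞 K) → PeriodPair),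
          IsRayClassReps (modulusIdeal (insert vbar S) (fun _ ↦ M)) T ∧
          (∀ 𝔟 ∈ T, ∀ z : ℂ, z ∈ (L 𝔟).lattice ↔
            ∃ x ∈ ((modulusIdeal (insert vbar S) (fun _ ↦ M) : FractionalIdeal (𝓞 K)⁰ K) /
              (𝔟 : FractionalIdeal (𝓞 K)⁰ K)), z = Ω * w₀.embedding x) ∧
          (∀ 𝔟 ∈ T, ∀ z : ℂ, z ∈ (L (𝔠 * 𝔟)).lattice ↔
            ∃ x ∈ ((modulusIdeal (insert vbar S) (fun _ ↦ M) : FractionalIdeal (𝓞 K)⁰ K) /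
              ((𝔠 * 𝔟 : Ideal (𝓞 K)) : FractionalIdeal (𝓞 K)⁰ K)), z = Ω * w₀.embedding x) ∧
          ((Ideal.absNorm 𝔠 : ℂ_[2]) -
              ((ι.symm (idealPow K χ 𝔠 * idealPow K (fun w ↦ lam.valueAtUniformizer w) 𝔠 ^ m) : PadicAlgCl 2) :
                ℂ_[2])) * μ.integral (fun σ ↦ avatarValueAt e σ) =
            ((ι.symm ((1 - (ε.valueAtUniformizer v)⁻¹ * (((2 : ℕ) : ℂ))⁻¹) *
                ∑ 𝔟 ∈ T, (idealPow K χ 𝔟)⁻¹ * (idealPow K (fun w ↦ lam.valueAtUniformizer w) 𝔟 ^ m)⁻¹ *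
                  ((Ideal.absNorm 𝔠 : ℂ) * (L 𝔟).eisensteinE m Ω - (L (𝔠 * 𝔟)).eisensteinE m Ω)) : PadicAlgCl 2) :
              ℂ_[2]) * Ωp ^ m)
    (ε : HeckeCharacter K) (e : FramedGaloisRep K (PadicAlgCl 2) 1) (m : ℕ)
    (he : IsPAdicAvatarOutside S ι ε e) (hm : 3 ≤ m)
    (hε : ε.HasInfinityType (fun _ ↦ -(m : ℤ)) (fun _ ↦ ((0 : ℕ) : ℤ)))
    (hεu : ∀ w : HeightOneSpectrum (𝓞 K), w ∉ S → w ≠ vbar → ε.IsUnramifiedAt w)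
    (hcont : 𝒰.IsTowerContinuous (fun σ ↦ avatarValueAt e σ))
    (hL : LFunction.HasEntireContinuation (heckeLFunction ε)) :
    μ.integral (fun σ ↦ avatarValueAt e σ) =
      ((ι.symm (DeShalit1987.interpolationValue 2 v vbar S ε m 0 Ω δ (hL.continuation 0)) :
          PadicAlgCl 2) : ℂ_[2]) * Ωp ^ (m + 0) := by
  classical
  haveI : IsTotallyComplex K := hK.2
  haveI : IsPrincipalIdealRing (𝓞 K) := NumberField.classNumber_eq_one_iff.mp hh
  -- the unique infinite place
  obtain ⟨w₀⟩ : Nonempty (InfinitePlace K) := inferInstance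
  have hw₀ : ∀ w : InfinitePlace K, w = w₀ := by
    haveI := subsingleton_infinitePlace_of_finrank_eq_two (K := K) hK.1
    exact fun w ↦ Subsingleton.elim w w₀
  -- `𝒪_{v̄} ≅ ℤ₂`
  let e₂ : vbar.adicCompletionIntegers K ≃+* ℤ_[2] := padicIntEquivOfSplit K hK.1 hvbar hv hne.symm
  -- the auxiliary character `λ` of type `(1, 0)`, unramified off `v̄`
  obtain ⟨φ₀, hφ₀, hφ₀u⟩ := KatzJZeroUnique.exists_char_type_neg_one e₂ hw₀
  have hl : φ₀⁻¹.HasInfinityType (fun _ ↦ 1) (fun _ ↦ 0) := by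
    have h := hφ₀.inv
    have e1 : (-fun _ ↦ (-1 : ℤ) : InfinitePlace K → ℤ) = fun _ ↦ 1 := by funext w; simp
    have e0 : (-fun _ ↦ (0 : ℤ) : InfinitePlace K → ℤ) = fun _ ↦ 0 := by funext w; simp
    rwa [e1, e0] at h
  have hvbarT : vbar ∈ insert vbar S := Finset.mem_insert_self _ _
  have hlu : ∀ w : HeightOneSpectrum (𝓞 K), w ∉ insert vbar S → φ₀⁻¹.IsUnramifiedAt w :=
    fun w hw ↦ (hφ₀u w fun h ↦ hw (h ▸ hvbarT)).inv'
  -- the range character off `S ∪ {v̄}`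
  have hε' : ε.HasInfinityType (fun _ ↦ -(m : ℤ)) (fun _ ↦ 0) := by simpa using hε
  have hεu' : ∀ w : HeightOneSpectrum (𝓞 K), w ∉ insert vbar S → ε.IsUnramifiedAt w :=
    fun w hw ↦ hεu w (fun h ↦ hw (Finset.mem_insert_of_mem h)) (fun h ↦ hw (h ▸ hvbarT))
  -- the level: range decomposition at `M ≥ M₀`, seam at `M ≥ M₁`, rigidity at `M ≥ 1`
  obtain ⟨M₀, hM₀⟩ := KatzJZeroRange.exists_rayClassCharacter_range_decomposition hl hlu hε' hεu'
  obtain ⟨M₁, hsum⟩ := hsum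
  set M : ℕ := max (max M₀ M₁) 1 with hMdef
  have hMM₀ : M₀ ≤ M := (le_max_left _ _).trans (le_max_left _ _)
  have hMM₁ : M₁ ≤ M := (le_max_right _ _).trans (le_max_left _ _)
  have hM1 : 1 ≤ M := le_max_right _ _
  obtain ⟨hlmod, -, -, hχ, hval, -⟩ := hM₀ M hMM₀
  set χ : HeightOneSpectrum (𝓞 K) → ℂ := fun w ↦ (ε * φ₀⁻¹ ^ m)⁻¹.valueAtUniformizer w with hχdef
  have hw : ∀ u : (𝓞 K)ˣ, (u : 𝓞 K) - 1 ∈ modulusIdeal (insert vbar S) (fun _ ↦ M) → u = 1 :=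
    units_eq_one_of_sub_one_mem_modulusIdeal_const _ hvbarT e₂ hw₀ hM1
  have h𝔪1 : modulusIdeal (insert vbar S) (fun _ ↦ M) ≠ ⊤ := modulusIdeal_const_ne_top _ hvbarT hM1
  have h𝔪0 : modulusIdeal (insert vbar S) (fun _ ↦ M) ≠ ⊥ := modulusIdeal_ne_bot _ _
  -- the twisting prime `𝔠 ∉ S ∪ {v, v̄}`
  obtain ⟨q, hq⟩ := exists_heightOneSpectrum_not_mem (insert v (insert vbar S))
  have hqv : q ≠ v := fun h ↦ hq (h ▸ Finset.mem_insert_self _ _)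
  have hqT : q ∉ insert vbar S := fun h ↦ hq (Finset.mem_insert_of_mem h)
  have h𝔠0 : q.asIdeal ≠ ⊥ := q.ne_bot
  have h𝔠1 : q.asIdeal ≠ ⊤ := q.isPrime.ne_top
  have h𝔠cop : IsCoprime q.asIdeal (modulusIdeal (insert vbar S) (fun _ ↦ M)) := by
    rw [isCoprime_iff_forall_not_le h𝔪0]
    intro w hw' hqw
    have hwq : w = q := HeightOneSpectrum.ext (q.isMaximal.eq_of_le w.isPrime.ne_top hqw).symm
    rw [modulusIdeal_le_iff] at hw'
    exact hqT (hwq ▸ hw')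
  have h𝔠v : IsCoprime q.asIdeal v.asIdeal := by
    rw [Ideal.isCoprime_iff_sup_eq]
    exact q.isMaximal.coprime_of_ne v.isMaximal fun h ↦ hqv (HeightOneSpectrum.ext h)
  -- the seam at this data
  obtain ⟨T, L, hT, hLT, hL𝔠T, hid⟩ := hsum w₀ (φ₀⁻¹) M hMM₁ hl hlmod h𝔪1 hw χ hχ q.asIdeal h𝔠0 h𝔠cop h𝔠v
    ε e m he hm hε' hεu hcont hval hL
  -- the complex side (A8)
  have hA8 := KatzJZeroRange.twist_mul_interpolationValue_zero_eq_eulerFactor_mul_sum hK.1 w₀ 2 hvS hne.symm hl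
    hlmod h𝔪1 hw hχ hT h𝔠0 h𝔠cop hΩ δ L hLT hL𝔠T hε' hεu' hval hL hm
  -- the non-vanishing of the twisting coefficient
  have hx := absNorm_sub_classCoeff_ne_zero hK.1 w₀ hl hlmod hχ h𝔠0 h𝔠1 h𝔠cop hm
  -- cancellation
  set x : ℂ := idealPow K χ q.asIdeal * idealPow K (fun w ↦ (φ₀⁻¹).valueAtUniformizer w) q.asIdeal ^ m with hxdef
  set V : ℂ := DeShalit1987.interpolationValue 2 v vbar S ε m 0 Ω δ (hL.continuation 0) with hVdef
  have hR : ι.symm ((1 - (ε.valueAtUniformizer v)⁻¹ * (((2 : ℕ) : ℂ))⁻¹) *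
      ∑ 𝔟 ∈ T, (idealPow K χ 𝔟)⁻¹ * (idealPow K (fun w ↦ (φ₀⁻¹).valueAtUniformizer w) 𝔟 ^ m)⁻¹ *
        ((Ideal.absNorm q.asIdeal : ℂ) * (L 𝔟).eisensteinE m Ω - (L (q.asIdeal * 𝔟)).eisensteinE m Ω)) =
      ((Ideal.absNorm q.asIdeal : PadicAlgCl 2) - ι.symm x) * ι.symm V := by
    rw [← hA8, map_mul, map_sub, map_natCast]
  have hcoe : ((Ideal.absNorm q.asIdeal : ℂ_[2]) - ((ι.symm x : PadicAlgCl 2) : ℂ_[2])) =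
      ((((Ideal.absNorm q.asIdeal : PadicAlgCl 2) - ι.symm x : PadicAlgCl 2)) : ℂ_[2]) := by
    rw [UniformSpace.Completion.coe_sub]
    congr 1
    exact (map_natCast (UniformSpace.Completion.coeRingHom : PadicAlgCl 2 →+* ℂ_[2]) _).symm
  have hne0 : ((((Ideal.absNorm q.asIdeal : PadicAlgCl 2) - ι.symm x : PadicAlgCl 2)) : ℂ_[2]) ≠ 0 := by
    intro h0
    have h1 : ((Ideal.absNorm q.asIdeal : PadicAlgCl 2) - ι.symm x : PadicAlgCl 2) = 0 :=
      UniformSpace.Completion.coe_injective (PadicAlgCl 2) (h0.trans UniformSpace.Completion.coe_zero.symm)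
    have h2 : ι.symm ((Ideal.absNorm q.asIdeal : ℂ) - x) = 0 := by rw [map_sub, map_natCast, h1]
    exact hx (EmbeddingLike.map_eq_zero_iff.mp h2)
  have hne0' : ((Ideal.absNorm q.asIdeal : ℂ_[2]) - ((ι.symm x : PadicAlgCl 2) : ℂ_[2])) ≠ 0 := by
    rw [hcoe]; exact hne0
  rw [hR, UniformSpace.Completion.coe_mul, ← hcoe] at hid
  rw [Nat.add_zero]
  exact mul_left_cancel₀ hne0' (hid.trans (mul_assoc _ _ _))

end Summit.BirchSwinnertonDyer.BirchSwinnertonDyer.Theorems.PrintCf2.KatzMeasureJZeroTop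

end
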